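import Summits.CriticalPhenomena.Ising3DConformalLimit.Theorems.ArmDressingArmDressingGlueDressedLimitExists
import Summits.CriticalPhenomena.Ising3DConformalLimit.Theorems.ArmDressingArmDressingGlueWiredBoxLimit
import Summits.CriticalPhenomena.Ising3DConformalLimit.Theorems.ArmDressingArmDressingGlueArm1Pos
import Summits.CriticalPhenomena.Ising3DConformalLimit.Theorems.ArmDressingArmDressingGlueEdwardsSokal
import Summits.CriticalPhenomena.Ising3DConformalLimit.Theorems.MoebiusLimitExists.Negative.ScaleFree
import Literature.Probability.LatticeModels.PointwiseScalingLimitEtaExists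
import HarnessLib

/-!
# Route `ArmDressing`, crux `ArmDressingGlue` (stmt-CriticalPhenomena-15700):
# stub `stub_axisTwoPoint`

Axis two-point asymptotics IN ONE-ARM UNITS (skeleton v3 of the line `registered` of the crux
`ArmDressingGlue`): from cruxes B (`EvenPatternDecoupling`) and C (`ArmExtensionFactorisation`),
there are `0 < c`, `C` and `k₀` with

  `c · a(k)² ≤ ⟨σ_0 σ_{k e₁}⟩⁺_{β_c(3)} ≤ C · a(k)²` for all `k ≥ k₀`,

where `a(k) := arm1 k⁻¹ 1` is the critical FK-Ising probability that the origin is connected to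
Euclidean lattice distance `≥ k`.

Proof.  The support ES holds (its three landed clauses `stub_wiredBoxLimit`, `stub_arm1Pos`,
`stub_edwardsSokalIdentity`, repacked by `infiniteVolumeEdwardsSokal_iff`), so the dressed limit
exists (`DressedLimitProof.stub_dressedLimitExists`, Camia–Feng Thm 1 transposed): a family `S`
with `HasPointwiseScalingLimit (criticalCorr 3) rho1 S` and `0 < S₂` off the diagonal.  Read at the
reference pair `(0, e₁)` along the integer meshes `δ = 1/k` (tree:
`HasPointwiseScalingLimit.tendsto_renorm_sq_mul_axis`, where `latticeApprox (1/k) e₁ = k e₁` is exact),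
`rho1(1/k)² ⟨σ_0σ_{k e₁}⟩ → σ := S₂(0, e₁) > 0`; hence eventually the sequence lies in `(σ/2, 2σ)`,
and since `rho1(1/k) = a(k)⁻¹` with `a(k) > 0` for `k ≥ 1` (`Arm1Pos`), multiplying through by
`a(k)²` gives the claim with `c = σ/2`, `C = 2σ`.

References: F. Camia, Y. Feng, arXiv:2411.01467 (SPA 2025), Thm 1 and the remark after it
(one-arm renormalisation); G. Grimmett, *The Random-Cluster Model* (2006), Thm 4.19.
-/

noncomputable section

namespace Summit.CriticalPhenomena.Ising3DConformalLimit.Cruxes.ArmDressingGlue.CrossPos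

open Summit.CriticalPhenomena.Ising3DConformalLimit.Cruxes.ArmDressingGlue.Vocab
open Summit.CriticalPhenomena.Ising3DConformalLimit.Theses
open scoped Topology
open Filter Literature.Probability.LatticeModels Literature.Probability.Percolation
open Literature.Barriers.CriticalPhenomena

/-- **STUB `stub_axisTwoPoint` — axis two-point asymptotics in one-arm units**: from cruxes B and C
(through the support ES and the dressed limit `S` of `DressedLimitProof.stub_dressedLimitExists`),
`c a(k)² ≤ ⟨σ_0σ_{k e₁}⟩⁺_{β_c(3)} ≤ C a(k)²` for `k ≥ k₀`, with `a(k) = arm1 k⁻¹ 1`, `c = S₂(0,e₁)/2`,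
`C = 2 S₂(0,e₁)`: the renormalised axis two-point function `a(k)⁻² ⟨σ_0σ_{k e₁}⟩` converges to
`S₂(0, e₁) > 0` along the meshes `δ = 1/k`. [cite: CamiaFeng2025, Thm 1] -/
theorem stub_axisTwoPoint :
    ArmDressing.EvenPatternDecoupling → ArmDressing.ArmExtensionFactorisation →
      ∃ (c C : ℝ) (k₀ : ℕ), 0 < c ∧ ∀ k : ℕ, k₀ ≤ k →
        c * arm1 (k : ℝ)⁻¹ 1 ^ 2 ≤ criticalTwoPoint 3 (Pi.single 0 (k : ℤ)) ∧
          criticalTwoPoint 3 (Pi.single 0 (k : ℤ)) ≤ C * arm1 (k : ℝ)⁻¹ 1 ^ 2 := by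
  intro hB hC
  -- the support ES from its three landed clauses
  have hW : WiredBoxLimit := WiredBoxLimitProof.stub_wiredBoxLimit
  have hpos : Arm1Pos := Arm1PosProof.stub_arm1Pos hW
  have hES : ArmDressing.InfiniteVolumeEdwardsSokal :=
    infiniteVolumeEdwardsSokal_iff.2 ⟨hW, hpos, EdwardsSokalProof.stub_edwardsSokalIdentity⟩
  -- the dressed limit and its value at the reference pair `(0, e₁)`
  obtain ⟨S, hlim, hnd⟩ := DressedLimitProof.stub_dressedLimitExists hB hC hES
  have hσ : 0 < S 2 ![0, EuclideanSpace.single (0 : Fin 3) (1:ℝ)] :=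
    hnd _ (zero_unitVec_mem_nonCoincident one_ne_zero)
  -- `rho1(1/k)² ⟨σ_0σ_{k e₁}⟩ → S₂(0,e₁)` along the integer meshes
  have ht := hlim.tendsto_renorm_sq_mul_axis
  obtain ⟨k₀, hk₀⟩ := eventually_atTop.1
    (((ht.eventually_const_lt (half_lt_self hσ)).and
      (ht.eventually_lt_const (lt_two_mul_self hσ))).and (eventually_ge_atTop 1))
  refine ⟨S 2 ![0, EuclideanSpace.single (0 : Fin 3) (1:ℝ)] / 2,
    2 * S 2 ![0, EuclideanSpace.single (0 : Fin 3) (1:ℝ)], k₀, half_pos hσ, fun k hk => ?_⟩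
  obtain ⟨⟨h1, h2⟩, hk1⟩ := hk₀ k hk
  -- `a(k) > 0` for `k ≥ 1`, and `rho1 (1/k) = a(k)⁻¹`
  have hkpos : (0:ℝ) < k := Nat.cast_pos.2 hk1
  have ha : 0 < arm1 (k : ℝ)⁻¹ 1 :=
    hpos _ ⟨inv_pos.2 hkpos, inv_le_one_of_one_le₀ (Nat.one_le_cast.2 hk1)⟩
  have ha2 : 0 < arm1 (k : ℝ)⁻¹ 1 ^ 2 := pow_pos ha 2
  have hrho : rho1 (1 / (k:ℝ)) ^ 2 * criticalTwoPoint 3 (Pi.single 0 (k : ℤ)) =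
      criticalTwoPoint 3 (Pi.single 0 (k : ℤ)) / arm1 (k : ℝ)⁻¹ 1 ^ 2 := by
    simp only [rho1, one_div, inv_pow]
    rw [div_eq_inv_mul]
  rw [hrho] at h1 h2
  exact ⟨((lt_div_iff₀ ha2).1 h1).le, ((div_lt_iff₀ ha2).1 h2).le⟩

end Summit.CriticalPhenomena.Ising3DConformalLimit.Cruxes.ArmDressingGlue.CrossPos

end
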